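import Literature.Probability.Percolation.CerfUniquenessZoneBound
import Literature.Probability.Percolation.CriticalContinuityProofs
import HarnessLib

/-!
# Crux `PercShatteringRace.NearLinearTwoClusterDecay` (stmt-CriticalPhenomena-5785) — engine stub E3 `stub_bootstrapInit`

Helper file of the line `pair-decay-long-arms-dense` (lead c5); lands with `--supports stmt-CriticalPhenomena-5785`
(registered stub `stub_bootstrapInit` of skeleton rev L5-c5).

## Statement

`stub_bootstrapInit`: there are real `A ≥ 1`, `ζ > 0` such that (under the guard `0 < θ(p_c)`, which
is not used) for some `C` and all large `u : ℕ`,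
`P_{p_c(ℤ³)}((uniqZone u ⌈u^A⌉₊)ᶜ) ≤ C u^{-ζ}` — SOME polynomial rate for the failure of the
uniqueness zone at SOME polynomial aspect, for bond percolation on `ℤ³` at `p = p_c`. This is the
start (E3) of the bootstrap over aspect exponents of the line.

## Proof sketch

* `p_c(ℤ³) ∈ (0,1)` (`Grimmett1999_criticalProb_pos_lt_one_holds`, Grimmett 1999 Thm (1.10)), so with
  `δ = min p_c (1 - p_c) > 0` the tree's Duminil-Copin–Kozma–Tassion 2020 Proposition 1
  (`AKN.dkt_prop1`, uniform on `p ∈ [δ, 1-δ]`) applies at `p = p_c`: there are `α ∈ (0,1)` and `n₁`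
  with `P_{p_c}((uniqZone ⌊n^α⌋₊ n)ᶜ) ≤ n^{-α}` for all `n ≥ n₁`
  (`exists_real_compl_uniqZone_floor_le`).
* Witnesses `A = 2/α ≥ 2`, `ζ = 2`, `C = 1`. For `u ≥ max n₁ 1` put `N = ⌈u^A⌉₊`; then
  `N ≥ u^A ≥ u ≥ n₁`, and `N^α ≥ (u^A)^α = u² ≥ u`, so `u ≤ ⌊N^α⌋₊`.
* `uniqZone k n` is ANTITONE in the inner radius `k` (more pairs are quantified over;
  `uniqZone_anti_left`, from `box_mono`), so `(uniqZone u N)ᶜ ⊆ (uniqZone ⌊N^α⌋₊ N)ᶜ` and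
  `P((uniqZone u N)ᶜ) ≤ P((uniqZone ⌊N^α⌋₊ N)ᶜ) ≤ N^{-α} ≤ (u^A)^{-α} = u^{-2}`
  (antitonicity of `x ↦ x^{-α}`, `Real.rpow_le_rpow_of_nonpos`).

## References

* H. Duminil-Copin, G. Kozma, V. Tassion, *Upper bounds on the percolation correlation length*,
  in: *In and Out of Equilibrium 3: Celebrating Vladas Sidoravicius*, Progress in Probability 77,
  Birkhäuser 2021, arXiv:1902.03207, Proposition 1 and §7 [DuminilcopinKozmaTassion2020].
* G. Grimmett, *Percolation*, 2nd ed., Springer 1999, §1.4 Theorem (1.10) [Grimmett1999].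
-/

noncomputable section

namespace Summit.CriticalPhenomena.PercolationContinuityZ3.Theorems

namespace NearLinearTwoClusterDecayBootstrapInit

open MeasureTheory Filter Topology
open Literature.Probability.LatticeModels Literature.Probability.Percolation

/-- **The uniqueness zone is antitone in the inner radius**: if `k ≤ k'` then
`uniqZone k' n ⊆ uniqZone k n` (the defining property quantifies over pairs of `Λ_k ⊆ Λ_{k'}`).
[folklore] -/
theorem uniqZone_anti_left {d k k' : ℕ} (h : k ≤ k') (n : ℕ) :
    uniqZone (d := d) k' n ⊆ uniqZone (d := d) k n :=
  fun _ hω x hx y hy hbx hby => hω x (box_mono d h hx) y (box_mono d h hy) hbx hby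

/-- **Duminil-Copin–Kozma–Tassion 2020 Proposition 1 at `p = p_c(ℤ³)`** (bond): there are
`α ∈ (0,1)` and `n₁` with `P_{p_c}((uniqZone ⌊n^α⌋₊ n)ᶜ) ≤ n^{-α}` for all `n ≥ n₁`; the tree's
uniform-in-`p ∈ [δ, 1-δ]` form `AKN.dkt_prop1` applied with `δ = min p_c (1 - p_c) > 0`
(`0 < p_c(ℤ³) < 1`, `Grimmett1999_criticalProb_pos_lt_one_holds`).
[cite: DuminilcopinKozmaTassion2020, Prop 1 and §7] -/
theorem exists_real_compl_uniqZone_floor_le :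
    ∃ α : ℝ, 0 < α ∧ α < 1 ∧ ∃ n₁ : ℕ, ∀ n : ℕ, n₁ ≤ n →
      (bondPercolation (zdGraph 3) (criticalProbI 3)).real (uniqZone (d := 3) ⌊(n : ℝ) ^ α⌋₊ n)ᶜ ≤
        (n : ℝ) ^ (-α) := by
  -- `0 < p_c(ℤ³) < 1` (Grimmett 1999 Thm (1.10), proved in the tree)
  have hpc : 0 < ((criticalProbI 3 : unitInterval) : ℝ) ∧ ((criticalProbI 3 : unitInterval) : ℝ) < 1 := by
    rw [coe_criticalProbI]
    exact Grimmett1999_criticalProb_pos_lt_one_holds 3 (by norm_num)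
  have hδ0 : 0 < min ((criticalProbI 3 : unitInterval) : ℝ) (1 - ((criticalProbI 3 : unitInterval) : ℝ)) :=
    lt_min hpc.1 (sub_pos.2 hpc.2)
  obtain ⟨α, hα0, hα1, n₁, hn₁⟩ := AKN.dkt_prop1 (d := 3) (by norm_num) hδ0
  refine ⟨α, hα0, hα1, n₁, fun n hn => hn₁ n hn (criticalProbI 3) (min_le_left _ _) ?_⟩
  have := min_le_right ((criticalProbI 3 : unitInterval) : ℝ) (1 - ((criticalProbI 3 : unitInterval) : ℝ))
  linarith

end NearLinearTwoClusterDecayBootstrapInit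

open MeasureTheory Filter Topology
open Literature.Probability.LatticeModels Literature.Probability.Percolation
open NearLinearTwoClusterDecayBootstrapInit

/-- **Engine stub E3 `stub_bootstrapInit` of the line `pair-decay-long-arms-dense`** (registered): SOME two-cluster
rate at `p_c(ℤ³)` — there are `A ≥ 1`, `ζ > 0` with `P_{p_c}((uniqZone u ⌈u^A⌉)ᶜ) ≤ C u^{-ζ}` eventually
(Duminil-Copin–Kozma–Tassion 2020 Prop 1 = `AKN.dkt_prop1`, with `A = 2/α`, `ζ = 2`).
[cite: DuminilcopinKozmaTassion2020, Prop 1] -/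
theorem stub_bootstrapInit :
    ∃ A ζ : ℝ, 1 ≤ A ∧ 0 < ζ ∧
    (0 < theta (zdGraph 3) 0 (criticalProbI 3) → ∃ C : ℝ, ∀ᶠ u : ℕ in atTop,
      (bondPercolation (zdGraph 3) (criticalProbI 3)).real (@uniqZone 3 u ⌈(u : ℝ) ^ A⌉₊)ᶜ ≤
        C * (u : ℝ) ^ (-ζ)) := by
  obtain ⟨α, hα0, hα1, n₁, hn₁⟩ := exists_real_compl_uniqZone_floor_le
  have hA1 : 1 ≤ 2 / α := by
    rw [le_div_iff₀ hα0]; linarith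
  refine ⟨2 / α, 2, hA1, two_pos, fun _ => ⟨1, Filter.eventually_atTop.2 ⟨max n₁ 1, fun u hu => ?_⟩⟩⟩
  have hun₁ : n₁ ≤ u := le_of_max_le_left hu
  have hu1 : (1 : ℝ) ≤ u := by exact_mod_cast le_of_max_le_right hu
  have hu0 : (0 : ℝ) ≤ u := zero_le_one.trans hu1
  have huApos : 0 < (u : ℝ) ^ (2 / α) := Real.rpow_pos_of_pos (zero_lt_one.trans_le hu1) _
  -- the outer radius `N = ⌈u^A⌉₊ ≥ u^A ≥ u ≥ n₁`
  set N := ⌈(u : ℝ) ^ (2 / α)⌉₊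
  have huAN : (u : ℝ) ^ (2 / α) ≤ N := Nat.le_ceil _
  have huN : (u : ℝ) ≤ N := (Real.self_le_rpow_of_one_le hu1 hA1).trans huAN
  have hn₁N : n₁ ≤ N := hun₁.trans (by exact_mod_cast huN)
  -- `u ≤ ⌊N^α⌋₊` since `N^α ≥ (u^A)^α = u² ≥ u`
  have hufl : u ≤ ⌊(N : ℝ) ^ α⌋₊ := by
    refine Nat.le_floor ?_
    calc (u : ℝ) ≤ (u : ℝ) ^ (2 : ℝ) := Real.self_le_rpow_of_one_le hu1 (by norm_num)
      _ = ((u : ℝ) ^ (2 / α)) ^ α := by rw [← Real.rpow_mul hu0, div_mul_cancel₀ _ hα0.ne']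
      _ ≤ (N : ℝ) ^ α := Real.rpow_le_rpow huApos.le huAN hα0.le
  -- antitonicity in the inner radius
  have hincl : (uniqZone (d := 3) u N)ᶜ ⊆ (uniqZone (d := 3) ⌊(N : ℝ) ^ α⌋₊ N)ᶜ :=
    Set.compl_subset_compl.2 (uniqZone_anti_left hufl N)
  -- `N^{-α} ≤ (u^A)^{-α} = u^{-2}`
  have hNα : (N : ℝ) ^ (-α) ≤ (u : ℝ) ^ (-(2 : ℝ)) :=
    calc (N : ℝ) ^ (-α) ≤ ((u : ℝ) ^ (2 / α)) ^ (-α) :=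
          Real.rpow_le_rpow_of_nonpos huApos huAN (neg_nonpos.2 hα0.le)
      _ = (u : ℝ) ^ (-(2 : ℝ)) := by rw [← Real.rpow_mul hu0, mul_neg, div_mul_cancel₀ _ hα0.ne']
  calc (bondPercolation (zdGraph 3) (criticalProbI 3)).real (uniqZone (d := 3) u N)ᶜ
        ≤ (bondPercolation (zdGraph 3) (criticalProbI 3)).real (uniqZone (d := 3) ⌊(N : ℝ) ^ α⌋₊ N)ᶜ :=
        measureReal_mono hincl (measure_ne_top _ _)
    _ ≤ (N : ℝ) ^ (-α) := hn₁ N hn₁N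
    _ ≤ (u : ℝ) ^ (-(2 : ℝ)) := hNα
    _ = 1 * (u : ℝ) ^ (-(2 : ℝ)) := (one_mul _).symm

end Summit.CriticalPhenomena.PercolationContinuityZ3.Theorems
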